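import Summits.CriticalPhenomena.PercolationContinuityZ3.Theorems.PercNearOneGluingNoHeavyQuantGluedForestSDEC
import HarnessLib

/-!
# QUANT lane R8, T-DEC: THE GAPPED TRIPLE `(R¹[q](R³[s]))³` — part 1: its forest law on the atoms that matter, its RESIDUAL in closed form
# (`0, 2, 3, 4, 9`) and the six inequalities of its two-pair RESID-DEC certificate (census-1 gen 24)

builds on p205010 (kernel theorem, internal audit signed; external expert review pending)

Support file (`--supports stmt-CriticalPhenomena-4575`), QUANT lane seat prim-quant-census-1 (gen 24); memo
`run/shared/lean/prim/quant/prim-quant-census-1/RESID-DEC-G24.md` §6.  Theorems only (no definitions, no `@[conjecture]`), standard axioms, no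
sorries.  Uses arm-1 g49's `gluedSib` binder (`…QuantGluedForestSDEC`).  The sequel `…QuantGappedForestSDEC` assembles the certificate.

THE FAMILY.  `t = R¹[q](R³[s])`: a root of gate `q` with ONE relay, one child of gate `s` with THREE relays — census-2 g74/g75's and lead g47's
GAPPED family, the one class where the free caterpillar hull (route 2, README V430/V431) FAILS at its natural floor (`s = 3/5`, `q ≥ .9`, floor
`qs ≥ .54`); RESID-DEC certifies it at every tested gate (RESID-DEC-G24 §2).  Forest `L = [t,t,t]`, `fmean = 3q(1+3s)`, top `12`, forest-law atoms
`{0,1,2,3,4,5,6,8,9,12}` (`gappedF2_apply`, `gappedF3_apply_*`).  THE RESIDUAL (`resid_gapped`, `resid_gapped_four`; `D = 2 − q − aq`,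
`E = (1−aq) + a(1−q)`): `R_a(0) = (2−q)(1−aq)²/D`, `R_a(1) = 0` (`resid_eq_zero_below`), `R_a(2) = 3aq(1−q)(1−aq)(1−s)²/D`,
`R_a(3) = aq²(1−s)³E/D`, `R_a(4) = 0` (the single-root pattern cancels), `R_a(9) = 3aq²s²(1−s)E/D`.
THE CERTIFICATE (target `T = a·fmean = u·W`, `u = aq`, `W = 3 + 9s`; floor `y = a·x ≤ aqs`; region `s ≤ 3/5`, so `T ≤ 42/5 < 10` and every charged atom
`≥ 5` is self-sufficient): `T ≤ 4` — no positive low atom (arm-1 g49); `4 < T ≤ 6` — ONE low atom `2`, peeled onto `9` at `γ = max(y, (T−4)/7)`;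
`T > 6` — TWO low atoms `2, 3`, both peeled onto `9` at the COMMON gate `γ = max(y, (T−4)/7)`.  The inequalities, in reduced variables:
`gapped_tor_two` (`2 ≤ 3u + 2us`), `gapped_tor_three` (`1 ≤ u + us`), `gapped_I3` (`(1−u)(1−s) ≤ s(1−us)`), `gapped_I4`
(`(1−u)(1−s)(T−4) ≤ us²(11−T)`), `gapped_I5` (`3(1−u)(1−s) + u(1−s)² ≤ 3s(1−us)`), `gapped_I8` (`[3(1−u)(1−s) + u(1−s)²](T−4) ≤ 3us²(11−T)`) —
each `nlinarith` from products of the regime constraints (numerical margins ≥ 2 % absolute on the region, census code `code-g24/gapped4.py`).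

* laws: `gappedG_apply`, `gappedF2_apply`/`gappedF2_eq`, `gappedF3_apply_zero/two/three/four/nine`, `gappedG_eq_zero`, `flaw_gapped`, `wco_three`,
  **`resid_gapped`**, **`resid_gapped_four`**; inequalities: `gapped_tor_two`, `gapped_tor_three`, `gapped_I3`, `gapped_I4`, `gapped_I5`, `gapped_I8`.

HONEST STATUS: law identities and real inequalities only; `ResidDEC`, `SiblingStep`, `GateStepN`, `FarTreeRow` OPEN; RATE class log\* / honest
sentence of `run/shared/lean/prim/quant/README.md` unchanged.  [this work]; binder: prim-quant-arm-1 g49; the gapped family as the hull's adverse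
class: prim-quant-census-2 g74/g75, prim-quant-lead g47.  Nothing here is cited as a published result.  The gluing rows served
[cite: KozmaNitzan2024, Conjecture 3 (p. 15)]; product measure [cite: Grimmett1999, §1.3 p. 10].
-/

noncomputable section

open scoped BigOperators

namespace Summit.CriticalPhenomena.PercolationContinuityZ3.Theorems
namespace Quant
namespace LawDec

open Finset

/-- the point mass `δ_K` -/
local notation3 "δ[" K "]" => (fun k : ℕ => if k = (K : ℕ) then (1 : ℝ) else 0)

/-! ### The gapped sibling `R¹[q](R³[s])` and its forest law -/

/-- the gated gapped sibling `gate (δ₁ ∗ gate δ₃ s) q` pointwise: atoms `0` (`1−q`), `1` (`q(1−s)`), `4` (`qs`). [this work] -/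
theorem gappedG_apply (q s : ℝ) (h : ℕ) :
    gate (slice δ[1] 3 s) q h = (if h = 0 then 1 - q else 0) + (if h = 1 then q * (1 - s) else 0) + (if h = 4 then q * s else 0) := by
  rw [gate_apply, gluedSib_rho_apply 1 3 le_rfl (by norm_num) s h]
  by_cases h0 : h = 0
  · subst h0; simp
  · by_cases h1 : h = 1
    · subst h1; simp
    · by_cases h4 : h = 4
      · subst h4; simp
      · rw [if_neg h1, if_neg (by omega), if_neg h0, if_neg h0, if_neg h1, if_neg h4]; ring

/-- the pair law `(gate ρ q)^{∗2}` of the gapped sibling pointwise (atoms `0,1,2,4,5,8`). [this work] -/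
theorem gappedF2_apply (q s : ℝ) (h : ℕ) :
    lconv 4 4 (gate (slice δ[1] 3 s) q) (gate (slice δ[1] 3 s) q) h =
      (if h = 0 then (1 - q) ^ 2 else 0) + (if h = 1 then 2 * (1 - q) * (q * (1 - s)) else 0) +
      (if h = 2 then (q * (1 - s)) ^ 2 else 0) + (if h = 4 then 2 * (1 - q) * (q * s) else 0) +
      (if h = 5 then 2 * (q * (1 - s)) * (q * s) else 0) + (if h = 8 then (q * s) ^ 2 else 0) := by
  simp only [lconv, Finset.sum_range_succ, Finset.sum_range_zero, gappedG_apply]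
  by_cases h0 : h = 0
  · subst h0; norm_num; ring
  by_cases h1 : h = 1
  · subst h1; norm_num; ring
  by_cases h2 : h = 2
  · subst h2; norm_num; ring
  by_cases h3 : h = 3
  · subst h3; norm_num
  by_cases h4 : h = 4
  · subst h4; norm_num; ring
  by_cases h5 : h = 5
  · subst h5; norm_num; ring
  by_cases h6 : h = 6
  · subst h6; norm_num
  by_cases h7 : h = 7
  · subst h7; norm_num
  by_cases h8 : h = 8
  · subst h8; norm_num; ring
  rw [if_neg h0, if_neg h1, if_neg h2, if_neg h4, if_neg h5, if_neg h8]
  simp [show (0:ℕ) ≠ h from Ne.symm h0, show (1:ℕ) ≠ h from Ne.symm h1, show (2:ℕ) ≠ h from Ne.symm h2,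
    show (3:ℕ) ≠ h from Ne.symm h3, show (4:ℕ) ≠ h from Ne.symm h4, show (5:ℕ) ≠ h from Ne.symm h5,
    show (6:ℕ) ≠ h from Ne.symm h6, show (7:ℕ) ≠ h from Ne.symm h7, show (8:ℕ) ≠ h from Ne.symm h8]

/-- the pair law as a function. [this work] -/
theorem gappedF2_eq (q s : ℝ) :
    lconv 4 4 (gate (slice δ[1] 3 s) q) (gate (slice δ[1] 3 s) q) = fun h =>
      (if h = 0 then (1 - q) ^ 2 else 0) + (if h = 1 then 2 * (1 - q) * (q * (1 - s)) else 0) +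
      (if h = 2 then (q * (1 - s)) ^ 2 else 0) + (if h = 4 then 2 * (1 - q) * (q * s) else 0) +
      (if h = 5 then 2 * (q * (1 - s)) * (q * s) else 0) + (if h = 8 then (q * s) ^ 2 else 0) :=
  funext (gappedF2_apply q s)

/-- the triple law at `0`: `(1−q)³`. [this work] -/
theorem gappedF3_apply_zero (q s : ℝ) :
    lconv 8 4 (lconv 4 4 (gate (slice δ[1] 3 s) q) (gate (slice δ[1] 3 s) q)) (gate (slice δ[1] 3 s) q) 0 = (1 - q) ^ 3 := by
  rw [gappedF2_eq]; simp only [lconv, Finset.sum_range_succ, Finset.sum_range_zero, gappedG_apply]; norm_num; ring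

/-- the triple law at `2 = 2A`: `3(1−q)q²(1−s)²`. [this work] -/
theorem gappedF3_apply_two (q s : ℝ) :
    lconv 8 4 (lconv 4 4 (gate (slice δ[1] 3 s) q) (gate (slice δ[1] 3 s) q)) (gate (slice δ[1] 3 s) q) 2 =
      3 * (1 - q) * q ^ 2 * (1 - s) ^ 2 := by
  rw [gappedF2_eq]; simp only [lconv, Finset.sum_range_succ, Finset.sum_range_zero, gappedG_apply]; norm_num; ring

/-- the triple law at `3 = 3A`: `q³(1−s)³`. [this work] -/
theorem gappedF3_apply_three (q s : ℝ) :
    lconv 8 4 (lconv 4 4 (gate (slice δ[1] 3 s) q) (gate (slice δ[1] 3 s) q)) (gate (slice δ[1] 3 s) q) 3 =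
      q ^ 3 * (1 - s) ^ 3 := by
  rw [gappedF2_eq]; simp only [lconv, Finset.sum_range_succ, Finset.sum_range_zero, gappedG_apply]; norm_num; ring

/-- the triple law at `4 = A + B` (one root open with its child open, two roots closed): `3(1−q)²qs`. [this work] -/
theorem gappedF3_apply_four (q s : ℝ) :
    lconv 8 4 (lconv 4 4 (gate (slice δ[1] 3 s) q) (gate (slice δ[1] 3 s) q)) (gate (slice δ[1] 3 s) q) 4 =
      3 * (1 - q) ^ 2 * (q * s) := by
  rw [gappedF2_eq]; simp only [lconv, Finset.sum_range_succ, Finset.sum_range_zero, gappedG_apply]; norm_num; ring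

/-- the triple law at `9 = 3A + 2B`: `3q³s²(1−s)`. [this work] -/
theorem gappedF3_apply_nine (q s : ℝ) :
    lconv 8 4 (lconv 4 4 (gate (slice δ[1] 3 s) q) (gate (slice δ[1] 3 s) q)) (gate (slice δ[1] 3 s) q) 9 =
      3 * q ^ 3 * s ^ 2 * (1 - s) := by
  rw [gappedF2_eq]; simp only [lconv, Finset.sum_range_succ, Finset.sum_range_zero, gappedG_apply]; norm_num; ring

/-- the gated gapped sibling vanishes above `4`. [this work] -/
theorem gappedG_eq_zero (q s : ℝ) (h : ℕ) (hh : 4 < h) : gate (slice δ[1] 3 s) q h = 0 := by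
  rw [gappedG_apply, if_neg (by omega), if_neg (by omega), if_neg (by omega)]; ring

/-- the forest law of the gapped triple is the explicit triple convolution (any recorded floor). [this work] -/
theorem flaw_gapped (q s x₁ : ℝ) :
    flaw [gluedSib 1 3 q s x₁, gluedSib 1 3 q s x₁, gluedSib 1 3 q s x₁] =
      lconv 8 4 (lconv 4 4 (gate (slice δ[1] 3 s) q) (gate (slice δ[1] 3 s) q)) (gate (slice δ[1] 3 s) q) := by
  have hM : (gluedSib 1 3 q s x₁).M = 4 := rfl
  have hρ : (gluedSib 1 3 q s x₁).ρ = slice δ[1] 3 s := rfl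
  have hq : (gluedSib 1 3 q s x₁).q = q := rfl
  have e1 : lconv 0 4 (fun h => if h = 0 then (1 : ℝ) else 0) (gate (slice δ[1] 3 s) q) = gate (slice δ[1] 3 s) q :=
    funext fun k => lconv_delta_left 0 4 _ (gappedG_eq_zero q s) k
  simp only [flaw, ftop, hM, hρ, hq]
  rw [e1]

/-- `wco = rfac²` for three equal siblings. [this work] -/
theorem wco_three (a : ℝ) (g : Sib) : wco a [g, g, g] = rfac a g * rfac a g := by
  simp only [wco, rprod, mul_one, min_self]

/-- **THE RESIDUAL OF THE GAPPED TRIPLE IN CLOSED FORM ON THE ATOMS `0, 2, 3, 9`** (`D = 2 − q − aq`, `E = (1−aq) + a(1−q)`). [this work] -/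
theorem resid_gapped (q s x₁ a : ℝ) (hq0 : 0 < q) (hq1 : q < 1) (ha1 : a < 1) :
    resid a (wco a [gluedSib 1 3 q s x₁, gluedSib 1 3 q s x₁, gluedSib 1 3 q s x₁])
        [gluedSib 1 3 q s x₁, gluedSib 1 3 q s x₁, gluedSib 1 3 q s x₁] 0 = (2 - q) * (1 - a * q) ^ 2 / (2 - q - a * q) ∧
    resid a (wco a [gluedSib 1 3 q s x₁, gluedSib 1 3 q s x₁, gluedSib 1 3 q s x₁])
        [gluedSib 1 3 q s x₁, gluedSib 1 3 q s x₁, gluedSib 1 3 q s x₁] 2 =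
      3 * a * q * (1 - q) * (1 - a * q) * (1 - s) ^ 2 / (2 - q - a * q) ∧
    resid a (wco a [gluedSib 1 3 q s x₁, gluedSib 1 3 q s x₁, gluedSib 1 3 q s x₁])
        [gluedSib 1 3 q s x₁, gluedSib 1 3 q s x₁, gluedSib 1 3 q s x₁] 3 =
      a * q ^ 2 * (1 - s) ^ 3 * ((1 - a * q) + a * (1 - q)) / (2 - q - a * q) ∧
    resid a (wco a [gluedSib 1 3 q s x₁, gluedSib 1 3 q s x₁, gluedSib 1 3 q s x₁])
        [gluedSib 1 3 q s x₁, gluedSib 1 3 q s x₁, gluedSib 1 3 q s x₁] 9 =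
      3 * a * q ^ 2 * s ^ 2 * (1 - s) * ((1 - a * q) + a * (1 - q)) / (2 - q - a * q) := by
  set L := [gluedSib 1 3 q s x₁, gluedSib 1 3 q s x₁, gluedSib 1 3 q s x₁] with hL
  have haq1 : a * q < 1 := by nlinarith
  have hne : (1 - a * q) ≠ 0 := by nlinarith
  have h1a : (1 - a) ≠ 0 := by linarith
  have hq0' : q ≠ 0 := hq0.ne'
  have hD : (2 - q - a * q) ≠ 0 := by nlinarith
  have hw : wco a L = ((1 - q) / (1 - a * q)) * ((1 - q) / (1 - a * q)) := wco_three a _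
  have hF := flaw_gapped q s x₁
  have hFa := flaw_gapped (a * q) s x₁
  have hmap : L.map (Sib.scale a) = [gluedSib 1 3 (a * q) s x₁, gluedSib 1 3 (a * q) s x₁, gluedSib 1 3 (a * q) s x₁] := rfl
  have e : ∀ h, resid a (wco a L) L h = (gate (flaw L) a h - wco a L * flaw (L.map (Sib.scale a)) h) / (1 - wco a L) := fun h => rfl
  have h1w : 1 - (1 - q) / (1 - a * q) * ((1 - q) / (1 - a * q)) = q * (1 - a) * (2 - q - a * q) / ((1 - a * q) * (1 - a * q)) := by
    rw [div_mul_div_comm, one_sub_div (mul_ne_zero hne hne)]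
    congr 1
    ring
  refine ⟨?_, ?_, ?_, ?_⟩
  · rw [e, gate_apply, if_pos rfl, hmap, hL, hF, hFa, gappedF3_apply_zero, gappedF3_apply_zero, hw, h1w]
    field_simp
    ring
  · rw [e, gate_apply, if_neg (by norm_num), hmap, hL, hF, hFa, gappedF3_apply_two, gappedF3_apply_two, hw, h1w]
    field_simp
    ring
  · rw [e, gate_apply, if_neg (by norm_num), hmap, hL, hF, hFa, gappedF3_apply_three, gappedF3_apply_three, hw, h1w]
    field_simp
    ring
  · rw [e, gate_apply, if_neg (by norm_num), hmap, hL, hF, hFa, gappedF3_apply_nine, gappedF3_apply_nine, hw, h1w]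
    field_simp
    ring

/-- **the residual of the gapped triple does not charge the single-root atom `4 = A + B`** (equal root gates: the single-root pattern cancels
exactly, `r·(1−aq) = 1−q`). [this work] -/
theorem resid_gapped_four (q s x₁ a : ℝ) (hq0 : 0 < q) (hq1 : q < 1) (ha1 : a < 1) :
    resid a (wco a [gluedSib 1 3 q s x₁, gluedSib 1 3 q s x₁, gluedSib 1 3 q s x₁])
        [gluedSib 1 3 q s x₁, gluedSib 1 3 q s x₁, gluedSib 1 3 q s x₁] 4 = 0 := by
  set L := [gluedSib 1 3 q s x₁, gluedSib 1 3 q s x₁, gluedSib 1 3 q s x₁] with hL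
  have haq1 : a * q < 1 := by nlinarith
  have hne : (1 - a * q) ≠ 0 := by nlinarith
  have hw : wco a L = ((1 - q) / (1 - a * q)) * ((1 - q) / (1 - a * q)) := wco_three a _
  have hmap : L.map (Sib.scale a) = [gluedSib 1 3 (a * q) s x₁, gluedSib 1 3 (a * q) s x₁, gluedSib 1 3 (a * q) s x₁] := rfl
  have e : resid a (wco a L) L 4 = (gate (flaw L) a 4 - wco a L * flaw (L.map (Sib.scale a)) 4) / (1 - wco a L) := rfl
  rw [e, gate_apply, if_neg (by norm_num), hmap, hL, flaw_gapped q s x₁, flaw_gapped (a * q) s x₁, gappedF3_apply_four,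
    gappedF3_apply_four, hw, div_eq_zero_iff]
  left
  field_simp
  ring

/-! ### The inequalities of the certificate (reduced variables `u = a·q`, `W = 3 + 9s`, `T = u·W = a·fmean`) -/

/-- **torque safety, middle regime**: `4 < 3aq(1+3s)`, `s ≤ 3/5` ⟹ `2 ≤ 3aq + 2aqs` (so the pair `{2, 9; y}` has mean `2 + 7y ≤ T` for
`y ≤ aqs`): `3u + 2v − 2 = ½(3u + 9v − 4) + (5/2)(3u/5 − v)` with `u = aq`, `v = aqs ≤ 3u/5`. [this work] -/
theorem gapped_tor_two {a q s : ℝ} (ha0 : 0 < a) (hq0 : 0 < q) (hs : s ≤ 3 / 5) (hT : 4 < 3 * (a * q) * (1 + 3 * s)) :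
    2 ≤ 3 * (a * q) + 2 * (a * q * s) := by
  have hv : a * q * s ≤ 3 / 5 * (a * q) := by nlinarith [mul_pos ha0 hq0]
  nlinarith

/-- **torque safety, top regime**: `6 < 3aq(1+3s)`, `s ≤ 1` ⟹ `1 ≤ aq + aqs` (the pair `{3, 9; y}` has mean `3 + 6y ≤ T` for `y ≤ aqs`).
[this work] -/
theorem gapped_tor_three {a q s : ℝ} (hs0 : 0 < s) (hs1 : s ≤ 1) (hT : 6 < 3 * (a * q) * (1 + 3 * s)) :
    1 ≤ a * q + a * q * s := by
  have h1 : 2 * (1 + s) < a * q * (1 + 3 * s) * (1 + s) := by nlinarith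
  nlinarith

/-- **I3 (capacity, middle regime, floor gate)**: `(1−u)(1−s) ≤ s(1−us)` when `u(3+9s) > 4`, `s ≤ 3/5`, `u ≤ 1`:
`(3+9s)[s(2−u−us) − (1−u)] = (1−s−s²)(u(3+9s) − 4) + (14s² − 7s + 1)`. [this work] -/
theorem gapped_I3 (u s : ℝ) (hs0 : 0 < s) (hs : s ≤ 3 / 5) (hT : 4 < u * (3 + 9 * s)) :
    (1 - u) * (1 - s) ≤ s * (1 - u * s) := by
  have h1 : 0 ≤ 1 - s - s ^ 2 := by nlinarith
  have h2 : 0 ≤ (1 - s - s ^ 2) * (u * (3 + 9 * s) - 4) := mul_nonneg h1 (by linarith)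
  nlinarith [sq_nonneg (s - 1 / 4), h2]

/-- **I4 (capacity, middle regime, lever gate)**: `(1−u)(1−s)(uW−4) ≤ us²(11 − uW)` when `4 < uW ≤ 6`, `W = 3+9s`, `s ≤ 3/5`,
`0 < u ≤ 1`. [this work] -/
theorem gapped_I4 (u s : ℝ) (hu0 : 0 < u) (hu1 : u ≤ 1) (hs0 : 0 < s) (hs : s ≤ 3 / 5) (hT : 4 < u * (3 + 9 * s))
    (hT6 : u * (3 + 9 * s) ≤ 6) :
    (1 - u) * (1 - s) * (u * (3 + 9 * s) - 4) ≤ u * s ^ 2 * (11 - u * (3 + 9 * s)) := by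
  nlinarith [mul_nonneg (mul_nonneg (sub_nonneg.2 hu1) (by linarith : (0:ℝ) ≤ 1 - s)) (by linarith : (0:ℝ) ≤ u * (3 + 9 * s) - 4),
    mul_nonneg (by linarith : (0:ℝ) ≤ u * (3 + 9 * s) - 4) (by linarith : (0:ℝ) ≤ 6 - u * (3 + 9 * s)),
    mul_nonneg (sub_nonneg.2 hu1) (by linarith : (0:ℝ) ≤ 6 - u * (3 + 9 * s)),
    mul_pos hu0 hs0, sq_nonneg (3 * s - 1), mul_nonneg (mul_nonneg hu0.le hs0.le) hs0.le]

/-- **I5 (capacity, top regime, floor gate)**: `3(1−u)(1−s) + u(1−s)² ≤ 3s(1−us)` when `uW > 6`, `s ≤ 3/5`, `u ≤ 1`. [this work] -/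
theorem gapped_I5 (u s : ℝ) (hu0 : 0 < u) (hu1 : u ≤ 1) (hs : s ≤ 3 / 5) (hT : 6 < u * (3 + 9 * s)) :
    3 * (1 - u) * (1 - s) + u * (1 - s) ^ 2 ≤ 3 * s * (1 - u * s) := by
  have hs0 : 0 < s := by nlinarith
  nlinarith [mul_nonneg (sub_nonneg.2 hu1) (by linarith : (0:ℝ) ≤ u * (3 + 9 * s) - 6),
    mul_nonneg (sub_nonneg.2 hs) (by linarith : (0:ℝ) ≤ u * (3 + 9 * s) - 6), mul_pos hu0 hs0,
    mul_nonneg (sub_nonneg.2 hu1) (sub_nonneg.2 hs)]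

/-- **I8 (capacity, top regime, lever gate)**: `[3(1−u)(1−s) + u(1−s)²](uW − 4) ≤ 3us²(11 − uW)` when `uW > 6`, `s ≤ 3/5`, `u ≤ 1`.
[this work] -/
theorem gapped_I8 (u s : ℝ) (hu0 : 0 < u) (hu1 : u ≤ 1) (hs0 : 0 < s) (hs : s ≤ 3 / 5) (hT : 6 < u * (3 + 9 * s)) :
    (3 * (1 - u) * (1 - s) + u * (1 - s) ^ 2) * (u * (3 + 9 * s) - 4) ≤ 3 * u * s ^ 2 * (11 - u * (3 + 9 * s)) := by
  have hW : u * (3 + 9 * s) ≤ 3 + 9 * s := by nlinarith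
  have hs3 : 1 / 3 < s := by nlinarith
  nlinarith [mul_nonneg (sub_nonneg.2 hu1) (by linarith : (0:ℝ) ≤ u * (3 + 9 * s) - 6),
    mul_nonneg (sub_nonneg.2 hs) (by linarith : (0:ℝ) ≤ u * (3 + 9 * s) - 6), mul_pos hu0 hs0,
    mul_nonneg (sub_nonneg.2 hu1) (sub_nonneg.2 hs), mul_nonneg (mul_nonneg hu0.le hs0.le) (sub_nonneg.2 hu1),
    mul_nonneg (mul_nonneg hu0.le hs0.le) (sub_nonneg.2 hs), mul_nonneg (sub_nonneg.2 hu1) (by linarith : (0:ℝ) ≤ s - 1 / 3),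
    mul_nonneg (mul_nonneg (sub_nonneg.2 hu1) (sub_nonneg.2 hs)) (by linarith : (0:ℝ) ≤ u * (3 + 9 * s) - 6)]

end LawDec
end Quant
end Summit.CriticalPhenomena.PercolationContinuityZ3.Theorems
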